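import Summits.Schanuel.Schanuel.Theorems.RootDecomp1KTHLayerCell01

/-!
# RootDecomp1KTHLayerCell — lens 1, generation 40 «THE (T.H.) LAYER OF 33364: ORDER GRADING + LIOUVILLE TRANSCENDENCE-TYPE MEASURE + DIAZ RUNGS ON THE MOMENT CURVE» — continuation (RootDecomp1KTHLayerCell02): §3 the transcendence-type measure of `ℓ_b` (`measure_index`, `measure_logPow`)

(lens-1 g40 `RootDecomp1KTHLayerCell.lean` [HOME/decomp-schanuel-lens-1/g40/ sha256 b5224e65…a9df, 1031 l; NODE L1861 / REQUEST L1862; critic VERDICT L1866 (CLEARED, ONE THEOREM credit, RULE K-R27, port GO)]; port by census-1 gen 17 as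
`RootDecomp1KTHLayerCell01`–`04` — see the PORT NOTE of part 01; `--supports stmt-Schanuel-33364`; rung 0.)
-/

noncomputable section

open Complex Polynomial IntermediateField Filter Asymptotics LiouvilleNumber
open scoped Nat Topology

namespace Summit.Schanuel.Schanuel.Theorems.RootDecomp1KTHLayer

open Summit.Schanuel.Schanuel.Theorems.RootDecomp1KHyper
open Summit.Schanuel.Schanuel.Theorems.RootDecomp1KHyper.HyperCell
open Summit.Schanuel.Schanuel.Theorems.RootDecomp1KGeneric (not_technicalHypothesis_of_hyperLinLiouville LiouvilleOrder)
open Summit.Schanuel.Schanuel.Theorems.RootDecomp1KFiniteOrderCell (zF ellF liouvilleOrder_ellF ellF_pos ellF_le_one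
  linearIndependent_zF linLiouville_zF not_hyperLinLiouville_zF zF_in_scope_33364)
open Summit.Schanuel.Schanuel.Theorems.RootDecomp1KTwoBaseCell (liouvilleNumber_le partialSum_pos')
open Literature.Barriers.Schanuel (TechnicalHypothesis LargeTranscendenceDegree gridField gridField₂ gridExp
  trdeg_mono one_le_of_add_lt_mul)

/-! ## §3 The transcendence-type measure of the Liouville numbers `ℓ_b = Σ_k b^{-k!}`

Throughout `b : ℕ`, `2 ≤ b`, `ℓ = liouvilleNumber b`, `r_k = partialSum b k = p_k / b^{k!}`. -/

section Measure

variable {b : ℕ}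

/-- `1 < b` for a base `b ≥ 2` (real cast). -/
private theorem one_lt_base (hb : 2 ≤ b) : (1 : ℝ) < b := by exact_mod_cast lt_of_lt_of_le one_lt_two hb

/-- `2 ≤ b` for a base `b ≥ 2` (real cast). -/
private theorem two_le_base (hb : 2 ≤ b) : (2 : ℝ) ≤ b := by exact_mod_cast hb

/-- Tail of the Liouville series in base `m ≥ 2`: `r_k ≤ 2·m^{-(k+1)!}` (a private tree helper, re-proved). -/
private theorem remainder_le_two_div {m : ℝ} (hm : 2 ≤ m) (k : ℕ) : remainder m k ≤ 2 / m ^ (k + 1)! := by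
  have m1 : (1 : ℝ) < m := by linarith
  have h := remainder_lt' k m1
  have hhalf : (1 : ℝ) / m ≤ 1 / 2 := one_div_le_one_div_of_le two_pos hm
  have hpos : (0 : ℝ) < 1 - 1 / m := by linarith
  have hinv : (1 - 1 / m)⁻¹ ≤ 2 := by
    rw [inv_le_comm₀ hpos two_pos]
    linarith
  have hmk : (0 : ℝ) < 1 / m ^ (k + 1)! := by positivity
  calc remainder m k ≤ (1 - 1 / m)⁻¹ * (1 / m ^ (k + 1)!) := h.le
    _ ≤ 2 * (1 / m ^ (k + 1)!) := mul_le_mul_of_nonneg_right hinv hmk.le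
    _ = 2 / m ^ (k + 1)! := by ring

/-- The tail: `0 < ℓ_b − r_k ≤ 2/b^{(k+1)!}`. -/
theorem liouvilleNumber_sub_partialSum (hb : 2 ≤ b) (k : ℕ) :
    0 < liouvilleNumber (b : ℝ) - partialSum (b : ℝ) k ∧
      liouvilleNumber (b : ℝ) - partialSum (b : ℝ) k ≤ 2 / (b : ℝ) ^ (k + 1)! := by
  have m1 := one_lt_base hb
  have hrem : liouvilleNumber (b : ℝ) - partialSum (b : ℝ) k = remainder (b : ℝ) k := by
    rw [← partialSum_add_remainder m1 k]; ring
  rw [hrem]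
  exact ⟨remainder_pos m1 k, remainder_le_two_div (two_le_base hb) k⟩

/-- The convergents increase strictly. -/
theorem partialSum_strictMono (hb : 2 ≤ b) : StrictMono (partialSum (b : ℝ)) := by
  refine strictMono_nat_of_lt_succ fun k => ?_
  rw [partialSum_succ]
  have h0 : (0 : ℝ) < b := by linarith [one_lt_base hb]
  have : (0 : ℝ) < 1 / (b : ℝ) ^ (k + 1)! := by positivity
  linarith

/-- `|ℓ_b| ≤ 2` and `|r_k| ≤ 2` (tree: `0 < r_k < ℓ_b ≤ 3/2`). -/
theorem abs_le_two (hb : 2 ≤ b) (k : ℕ) :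
    |liouvilleNumber (b : ℝ)| ≤ 2 ∧ |partialSum (b : ℝ) k| ≤ 2 := by
  have h0 : (0 : ℝ) < b := by linarith [one_lt_base hb]
  have hr := partialSum_pos' h0 k
  have hℓ := liouvilleNumber_le (two_le_base hb)
  have ht := (liouvilleNumber_sub_partialSum hb k).1
  refine ⟨?_, ?_⟩
  · rw [abs_of_pos (by linarith)]; linarith
  · rw [abs_of_pos hr]; linarith

/-- **Lemma C (variation).** For `Q ∈ ℝ[X]`, `deg Q ≤ d`, `|coeff| ≤ H`, and `|x|, |y| ≤ 2`:
`|Q(x) − Q(y)| ≤ (d+1)·d·2^d · H · |x − y|`. -/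
theorem abs_eval_sub_eval_le {Q : ℝ[X]} {d : ℕ} (hdeg : Q.natDegree ≤ d) {H : ℝ}
    (hcoef : ∀ i, |Q.coeff i| ≤ H) {x y : ℝ} (hx : |x| ≤ 2) (hy : |y| ≤ 2) :
    |Q.eval x - Q.eval y| ≤ ((d + 1) * d * 2 ^ d : ℕ) * H * |x - y| := by
  have hH : 0 ≤ H := (abs_nonneg _).trans (hcoef 0)
  have hlt : Q.natDegree < d + 1 := Nat.lt_succ_of_le hdeg
  rw [eval_eq_sum_range' hlt, eval_eq_sum_range' hlt, ← Finset.sum_sub_distrib]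
  have hxy := abs_nonneg (x - y)
  have hterm : ∀ i ∈ Finset.range (d + 1),
      |Q.coeff i * x ^ i - Q.coeff i * y ^ i| ≤ H * ((d * 2 ^ d : ℕ) * |x - y|) := by
    intro i hi
    have hid : i ≤ d := Nat.lt_succ_iff.mp (Finset.mem_range.mp hi)
    rw [← mul_sub, abs_mul]
    refine mul_le_mul (hcoef i) ?_ (abs_nonneg _) hH
    have hmax : max |x| |y| ≤ 2 := max_le hx hy
    have hmax0 : 0 ≤ max |x| |y| := le_max_of_le_left (abs_nonneg _)
    have h1 : max |x| |y| ^ (i - 1) ≤ 2 ^ (i - 1) := pow_le_pow_left₀ hmax0 hmax _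
    have h2 : (2 : ℝ) ^ (i - 1) ≤ 2 ^ d := pow_le_pow_right₀ (by norm_num) (by omega)
    have hi' : (i : ℝ) ≤ d := by exact_mod_cast hid
    calc |x ^ i - y ^ i| ≤ |x - y| * i * max |x| |y| ^ (i - 1) := abs_pow_sub_pow_le x y i
      _ ≤ |x - y| * d * 2 ^ d :=
          mul_le_mul (mul_le_mul_of_nonneg_left hi' hxy) (h1.trans h2) (pow_nonneg hmax0 _)
            (by positivity)
      _ = (d * 2 ^ d : ℕ) * |x - y| := by push_cast; ring
  calc |∑ i ∈ Finset.range (d + 1), (Q.coeff i * x ^ i - Q.coeff i * y ^ i)|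
      ≤ ∑ i ∈ Finset.range (d + 1), |Q.coeff i * x ^ i - Q.coeff i * y ^ i| :=
        Finset.abs_sum_le_sum_abs _ _
    _ ≤ ∑ i ∈ Finset.range (d + 1), H * ((d * 2 ^ d : ℕ) * |x - y|) := Finset.sum_le_sum hterm
    _ = ((d + 1) * d * 2 ^ d : ℕ) * H * |x - y| := by
        rw [Finset.sum_const, Finset.card_range, nsmul_eq_mul]; push_cast; ring

/-- **Lemma A (a non-root).** Among `d + 1` consecutive convergents `r_k, …, r_{k+d}` one is not a root of a
nonzero `Q ∈ ℝ[X]` of degree `≤ d`. -/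
theorem exists_partialSum_not_root (hb : 2 ≤ b) {Q : ℝ[X]} (hQ : Q ≠ 0) {d : ℕ}
    (hdeg : Q.natDegree ≤ d) (k : ℕ) :
    ∃ j, k ≤ j ∧ j ≤ k + d ∧ Q.eval (partialSum (b : ℝ) j) ≠ 0 := by
  by_contra hall
  push Not at hall
  set Z : Finset ℝ := (Finset.range (d + 1)).image (fun t => partialSum (b : ℝ) (k + t)) with hZ
  have hinj : Function.Injective (fun t => partialSum (b : ℝ) (k + t)) := by
    intro s t hst
    have := (partialSum_strictMono hb).injective hst
    omega
  have hcard : Z.card = d + 1 := by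
    rw [hZ, Finset.card_image_of_injective _ hinj, Finset.card_range]
  have hsub : Z.val ⊆ Q.roots := by
    intro z hz
    obtain ⟨t, ht, rfl⟩ := Finset.mem_image.mp (Finset.mem_def.mpr hz)
    have ht' := Finset.mem_range.mp ht
    exact (mem_roots hQ).mpr (hall (k + t) (by omega) (by omega))
  have := card_le_degree_of_subset_roots hsub
  omega

/-- The grid constant `A_d := 4·(d+1)·d·2^d`. -/
def measConst (d : ℕ) : ℕ := 4 * ((d + 1) * d * 2 ^ d)

/-- **THE MEASURE, index form (Lemma B + A + C).** `b ≥ 2`, `P ∈ ℤ[X]` nonzero, `deg P ≤ d`, all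
`|coeff P| ≤ H`; if `k ≥ d + 1` and `A_d·H ≤ b^{k!}` then `|P(ℓ_b)| ≥ 1/(2·b^{d·(k+d)!})`.  (At the non-root
`r_j = p/b^{j!}`, `k ≤ j ≤ k + d`: `|P(r_j)| ≥ b^{−d·j!}` by clearing denominators, and
`|P(ℓ_b) − P(r_j)| ≤ (d+1)d2^d·H·2b^{−(j+1)!} ≤ ½ b^{−d·j!}`.)  No polynomial measure exists (`ℓ_b` is a
U-number); the point is that the exponent is FACTORIAL IN AN INDEX LOGARITHMIC IN `H`. -/
theorem measure_index (hb : 2 ≤ b) {d : ℕ} {P : ℤ[X]} (hP : P ≠ 0) (hdeg : P.natDegree ≤ d)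
    {H : ℝ} (hcoef : ∀ i, |((P.coeff i : ℤ) : ℝ)| ≤ H) {k : ℕ} (hk : d + 1 ≤ k)
    (hkH : (measConst d : ℝ) * H ≤ (b : ℝ) ^ k !) :
    1 / (2 * (b : ℝ) ^ (d * (k + d)!)) ≤
      |(P.map (algebraMap ℤ ℝ)).eval (liouvilleNumber (b : ℝ))| := by
  have b1 := one_lt_base hb
  have b0 : (0 : ℝ) < b := by linarith
  have hbpos : 0 < b := by omega
  have hH : 0 ≤ H := (abs_nonneg _).trans (hcoef 0)
  set Q : ℝ[X] := P.map (algebraMap ℤ ℝ) with hQdef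
  have hinj : Function.Injective (algebraMap ℤ ℝ) := (algebraMap ℤ ℝ).injective_int
  have hQ0 : Q ≠ 0 := fun h => hP ((Polynomial.map_eq_zero_iff hinj).mp h)
  have hQdeg : Q.natDegree ≤ d := by
    rw [hQdef, natDegree_map_eq_of_injective hinj]; exact hdeg
  have hQcoef : ∀ i, |Q.coeff i| ≤ H := fun i => by
    simpa [hQdef, coeff_map] using hcoef i
  -- Lemma A: a non-root among `r_k, …, r_{k+d}`
  obtain ⟨j, hkj, hjk, hj⟩ := exists_partialSum_not_root hb hQ0 hQdeg k
  -- `r_j = p / b^{j!}`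
  obtain ⟨p, hp⟩ := partialSum_eq_rat hbpos j
  have E : (((p : ℕ) : ℤ) : ℝ) / (((b ^ j ! : ℕ) : ℤ) : ℝ) = partialSum (b : ℝ) j := by
    rw [hp]; simp only [Int.cast_natCast]
  have hqpos : (0 : ℤ) < ((b ^ j ! : ℕ) : ℤ) := by exact_mod_cast pow_pos hbpos _
  set B : ℝ := (b : ℝ) ^ j ! with hBdef
  have hBq : (((b ^ j ! : ℕ) : ℤ) : ℝ) = B := by rw [hBdef]; norm_cast
  have hB1 : 1 ≤ B := by rw [hBdef]; exact one_le_pow₀ b1.le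
  have hB0 : 0 < B := by linarith
  have hBne : B ≠ 0 := hB0.ne'
  set A' : ℝ := (((d + 1) * d * 2 ^ d : ℕ) : ℝ) with hA'def
  have hA'0 : 0 ≤ A' := by rw [hA'def]; positivity
  -- Lemma B: `|Q(r_j)| ≥ 1/B^d`
  have hrat : 1 / B ^ d ≤ |Q.eval (partialSum (b : ℝ) j)| := by
    have hj' : eval ((((p : ℕ) : ℤ) : ℝ) / (((b ^ j ! : ℕ) : ℤ) : ℝ)) (P.map (algebraMap ℤ ℝ)) ≠ 0 := by
      rw [E]; exact hj
    have h1 := one_le_pow_mul_abs_eval_div (K := ℝ) (f := P) hqpos hj'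
    rw [E, hBq] at h1
    have hpowle : B ^ P.natDegree ≤ B ^ d := pow_le_pow_right₀ hB1 hdeg
    rw [div_le_iff₀ (pow_pos hB0 _), mul_comm]
    exact h1.trans (mul_le_mul_of_nonneg_right hpowle (abs_nonneg _))
  -- Lemma C: `|Q(ℓ) − Q(r_j)| ≤ A'·H·|ℓ − r_j|`, `A' = (d+1)d2^d`
  obtain ⟨hℓ2, hr2⟩ := abs_le_two hb j
  have hdiff := abs_eval_sub_eval_le hQdeg hQcoef hℓ2 hr2
  -- the tail `|ℓ − r_j| ≤ 2/B^{j+1}`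
  obtain ⟨htpos, htle⟩ := liouvilleNumber_sub_partialSum hb j
  have htail : |liouvilleNumber (b : ℝ) - partialSum (b : ℝ) j| ≤ 2 / B ^ (j + 1) := by
    rw [abs_of_pos htpos]
    have : (b : ℝ) ^ (j + 1)! = B ^ (j + 1) := by
      rw [hBdef, ← pow_mul, Nat.factorial_succ, mul_comm]
    rw [← this]; exact htle
  -- threshold: `4·A'·H ≤ b^{k!} ≤ B`
  have hkj' : (b : ℝ) ^ k ! ≤ B := pow_le_pow_right₀ b1.le (Nat.factorial_le hkj)
  have hcast : (measConst d : ℝ) = 4 * A' := by rw [hA'def]; norm_num [measConst]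
  have hAH : 4 * A' * H ≤ B := by rw [← hcast]; exact hkH.trans hkj'
  -- so the variation is at most `1/(2 B^d)`
  have hBd : 0 < B ^ d := pow_pos hB0 _
  have hBdne : B ^ d ≠ 0 := hBd.ne'
  have hvar : |Q.eval (liouvilleNumber (b : ℝ)) - Q.eval (partialSum (b : ℝ) j)| ≤
      1 / (2 * B ^ d) := by
    have hpow : B ^ d * B ≤ B ^ (j + 1) := by
      rw [← pow_succ]; exact pow_le_pow_right₀ hB1 (by omega)
    have hAH' : 2 * A' * H / B ≤ 1 / 2 := by
      rw [div_le_iff₀ hB0]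
      linarith
    calc |Q.eval (liouvilleNumber (b : ℝ)) - Q.eval (partialSum (b : ℝ) j)|
        ≤ A' * H * |liouvilleNumber (b : ℝ) - partialSum (b : ℝ) j| := hdiff
      _ ≤ A' * H * (2 / B ^ (j + 1)) := mul_le_mul_of_nonneg_left htail (by positivity)
      _ ≤ A' * H * (2 / (B ^ d * B)) :=
          mul_le_mul_of_nonneg_left (div_le_div_of_nonneg_left (by norm_num) (by positivity) hpow)
            (by positivity)
      _ = (2 * A' * H / B) / B ^ d := by ring
      _ ≤ (1 / 2) / B ^ d := div_le_div_of_nonneg_right hAH' hBd.le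
      _ = 1 / (2 * B ^ d) := by ring
  -- conclude: `|Q(ℓ)| ≥ |Q(r_j)| − |Q(ℓ) − Q(r_j)| ≥ 1/B^d − 1/(2B^d)`
  have hmain : 1 / (2 * B ^ d) ≤ |Q.eval (liouvilleNumber (b : ℝ))| := by
    have htri := abs_sub_abs_le_abs_sub (Q.eval (partialSum (b : ℝ) j)) (Q.eval (liouvilleNumber (b : ℝ)))
    rw [abs_sub_comm] at htri
    have : 1 / B ^ d - 1 / (2 * B ^ d) = 1 / (2 * B ^ d) := by ring
    linarith
  -- and `B^d = b^{d·j!} ≤ b^{d·(k+d)!}`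
  have hBle : 2 * B ^ d ≤ 2 * (b : ℝ) ^ (d * (k + d)!) := by
    have : B ^ d = (b : ℝ) ^ (j ! * d) := by rw [hBdef, pow_mul]
    rw [this]
    have hexp : j ! * d ≤ d * (k + d)! := by
      rw [mul_comm]; exact Nat.mul_le_mul_left d (Nat.factorial_le hjk)
    linarith [pow_le_pow_right₀ b1.le hexp]
  exact (one_div_le_one_div_of_le (by positivity) hBle).trans hmain

/-- A threshold index exists. -/
theorem exists_threshold (hb : 2 ≤ b) (d : ℕ) (T : ℝ) : ∃ k : ℕ, d + 1 ≤ k ∧ T ≤ (b : ℝ) ^ k ! := by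
  obtain ⟨n, hn⟩ := pow_unbounded_of_one_lt T (one_lt_base hb)
  refine ⟨max n (d + 1), le_max_right _ _, hn.le.trans ?_⟩
  exact pow_le_pow_right₀ (one_lt_base hb).le
    ((le_max_left _ _).trans (Nat.self_le_factorial _))

/-- `exp(−(log 2 + N·log b)) = 1/(2·b^N)`. -/
private theorem exp_neg_log_eq (hb : 2 ≤ b) (N : ℕ) :
    Real.exp (-(Real.log 2 + N * Real.log b)) = 1 / (2 * (b : ℝ) ^ N) := by
  have b0 : (0 : ℝ) < b := by linarith [one_lt_base hb]
  rw [Real.exp_neg, Real.exp_add, Real.exp_log two_pos, ← Real.log_pow, Real.exp_log (pow_pos b0 _),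
    one_div]

/-- Factorial growth across `d + 1` steps: `(m + d + 1)! ≤ m! · (m + d + 1)^{d+1}`. -/
private theorem factorial_add_le (m d : ℕ) : (m + d + 1)! ≤ m ! * (m + d + 1) ^ (d + 1) := by
  have h := Nat.factorial_mul_descFactorial (show d + 1 ≤ m + d + 1 by omega)
  have hsub : m + d + 1 - (d + 1) = m := by omega
  rw [hsub] at h
  rw [← h]
  exact Nat.mul_le_mul_left _ (Nat.descFactorial_le_pow _ _)

/-- **THE MEASURE, transcendence-type form.** For `b ≥ 2` and every degree `d` there is `C > 0` with
`|P(ℓ_b)| ≥ exp(−C·(log H)^{d+2})` for all nonzero `P ∈ ℤ[X]`, `deg P ≤ d`, `|coeff P| ≤ H`, `H ≥ 3`.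
(Take `k` MINIMAL in `measure_index`: then `b^{(k−1)!} < A_d H`, so `(k−1)! < 2 log(A_d H)` and
`(k+d)! ≤ (k−1)!·(k+d)^{d+1} ≪ (log H)^{d+2}`.)  In the language of Schmidt's invariant `β(ξ)`
(Bugeaud 2004, §7.1, p. 151) this gives `β(ℓ_b) = 0`; the effective log-power form per degree is what (T.H.) needs. -/
theorem measure_logPow (hb : 2 ≤ b) (d : ℕ) :
    ∃ C : ℝ, 0 < C ∧ ∀ P : ℤ[X], P ≠ 0 → P.natDegree ≤ d → ∀ H : ℝ, 3 ≤ H →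
      (∀ i, |((P.coeff i : ℤ) : ℝ)| ≤ H) →
      Real.exp (-(C * Real.log H ^ (d + 2))) ≤ |(P.map (algebraMap ℤ ℝ)).eval (liouvilleNumber (b : ℝ))| := by
  classical
  have b1 := one_lt_base hb
  have b0 : (0 : ℝ) < b := by linarith
  have hlogb : 1 / 2 < Real.log b := by
    have h2 : Real.log 2 ≤ Real.log b := Real.log_le_log two_pos (two_le_base hb)
    linarith [Real.log_two_gt_d9]
  have hlogb0 : 0 ≤ Real.log b := by linarith
  -- constants
  set A : ℝ := (measConst d : ℝ) with hAdef
  have hA0 : 0 ≤ A := by rw [hAdef]; positivity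
  set c₂ : ℝ := 2 * |Real.log A| + d + 3 with hc₂
  have hc₂0 : 0 ≤ c₂ := by rw [hc₂]; positivity
  set C₁ : ℝ := Real.log 2 + d * ((2 * d + 1)! : ℕ) * Real.log b with hC₁
  set C₂ : ℝ := Real.log 2 + d * c₂ ^ (d + 2) * Real.log b with hC₂
  have hlog2 : 0 < Real.log 2 := by linarith [Real.log_two_gt_d9]
  have hC₁0 : 0 < C₁ := by rw [hC₁]; positivity
  have hC₂0 : 0 < C₂ := by rw [hC₂]; positivity
  refine ⟨C₁ + C₂, by linarith, fun P hP hdeg H hH hcoef => ?_⟩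
  have hH0 : 0 < H := by linarith
  -- `t = log H ≥ 1`
  set t : ℝ := Real.log H with ht
  have ht1 : 1 ≤ t := by
    rw [ht, Real.le_log_iff_exp_le hH0]
    have := Real.exp_one_lt_d9
    linarith
  have ht0 : 0 ≤ t := by linarith
  have htpow : 1 ≤ t ^ (d + 2) := one_le_pow₀ ht1
  -- the minimal threshold index
  have hex : ∃ k : ℕ, d + 1 ≤ k ∧ A * H ≤ (b : ℝ) ^ k ! := exists_threshold hb d (A * H)
  obtain ⟨k, ⟨hk, hkH⟩, hmin⟩ : ∃ k : ℕ, (d + 1 ≤ k ∧ A * H ≤ (b : ℝ) ^ k !) ∧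
      ∀ m, m < k → ¬ (d + 1 ≤ m ∧ A * H ≤ (b : ℝ) ^ m !) :=
    ⟨Nat.find hex, Nat.find_spec hex, fun m hm => Nat.find_min hex hm⟩
  -- the index form
  have hI := measure_index hb hP hdeg hcoef hk hkH
  -- bound the exponent `log 2 + d·(k+d)!·log b ≤ (C₁ + C₂)·t^{d+2}`
  have hfact : (d : ℝ) * ((k + d)! : ℕ) * Real.log b ≤
      d * ((2 * d + 1)! : ℕ) * Real.log b + d * c₂ ^ (d + 2) * Real.log b * t ^ (d + 2) := by
    rcases Nat.lt_or_ge k (d + 2) with hlt | hge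
    · -- `k = d + 1`
      have hkeq : k = d + 1 := by omega
      have h1 : ((k + d)! : ℕ) = (2 * d + 1)! := by rw [hkeq]; congr 1; omega
      rw [h1]
      have : 0 ≤ (d : ℝ) * c₂ ^ (d + 2) * Real.log b * t ^ (d + 2) := by positivity
      linarith
    · -- `k ≥ d + 2`: minimality at `m = k − 1`
      obtain ⟨m, rfl⟩ : ∃ m, k = m + 1 := ⟨k - 1, by omega⟩
      have hm : d + 1 ≤ m := by omega
      have hnot := hmin m (by omega)
      have hlt' : (b : ℝ) ^ m ! < A * H := by
        exact lt_of_not_ge fun hle => hnot ⟨hm, hle⟩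
      have hAH0 : 0 < A * H := lt_of_le_of_lt (pow_pos b0 _).le hlt'
      -- `m! · log b < log (A H)` hence `m! < 2 log(AH)`
      have hlogAH : (m ! : ℝ) * Real.log b < Real.log (A * H) := by
        have := Real.log_lt_log (pow_pos b0 _) hlt'
        rwa [Real.log_pow] at this
      have hmf : (0 : ℝ) ≤ (m ! : ℕ) := Nat.cast_nonneg _
      have hfac2 : ((m ! : ℕ) : ℝ) < 2 * Real.log (A * H) := by nlinarith
      -- `log(AH) = log A + t ≤ |log A| + t`
      have hA0' : 0 < A := by
        rcases hA0.lt_or_eq with h | h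
        · exact h
        · exfalso
          rw [← h, zero_mul] at hAH0
          exact lt_irrefl _ hAH0
      have hlogAH' : Real.log (A * H) ≤ |Real.log A| + t := by
        rw [Real.log_mul hA0'.ne' hH0.ne']; linarith [le_abs_self (Real.log A)]
      -- `W := 2 log(AH) + 1 + d` bounds `m + d + 1` and `m!`
      set W : ℝ := 2 * Real.log (A * H) + 1 + d with hW
      have hmW : ((m ! : ℕ) : ℝ) ≤ W := by rw [hW]; have : (0:ℝ) ≤ d := Nat.cast_nonneg d; linarith
      have hm_le_fac : (m : ℝ) ≤ ((m ! : ℕ) : ℝ) := by exact_mod_cast Nat.self_le_factorial m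
      have hmdW : ((m + d + 1 : ℕ) : ℝ) ≤ W := by
        push_cast
        rw [hW]
        have : (0:ℝ) ≤ d := Nat.cast_nonneg d
        linarith
      have hW0 : 0 ≤ W := le_trans hmf hmW
      have hWc : W ≤ c₂ * t := by
        rw [hW, hc₂]
        have hlA : 0 ≤ |Real.log A| := abs_nonneg _
        have hd0 : (0 : ℝ) ≤ d := Nat.cast_nonneg d
        nlinarith [mul_nonneg (sub_nonneg.mpr ht1) hlA, mul_nonneg (sub_nonneg.mpr ht1) hd0, hlogAH', ht1]
      -- `(m+1+d)! ≤ m!·(m+d+1)^{d+1} ≤ W · W^{d+1} = W^{d+2} ≤ (c₂ t)^{d+2}`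
      have hfacle : (((m + 1 + d)! : ℕ) : ℝ) ≤ W ^ (d + 2) := by
        have h1 : (m + 1 + d)! ≤ m ! * (m + d + 1) ^ (d + 1) := by
          have := factorial_add_le m d
          rwa [show m + 1 + d = m + d + 1 by omega]
        have h2 : (((m + 1 + d)! : ℕ) : ℝ) ≤ ((m ! : ℕ) : ℝ) * ((m + d + 1 : ℕ) : ℝ) ^ (d + 1) := by
          exact_mod_cast h1
        calc (((m + 1 + d)! : ℕ) : ℝ) ≤ ((m ! : ℕ) : ℝ) * ((m + d + 1 : ℕ) : ℝ) ^ (d + 1) := h2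
          _ ≤ W * W ^ (d + 1) :=
              mul_le_mul hmW (pow_le_pow_left₀ (Nat.cast_nonneg _) hmdW _) (by positivity) hW0
          _ = W ^ (d + 2) := by ring
      have hWpow : W ^ (d + 2) ≤ (c₂ * t) ^ (d + 2) := pow_le_pow_left₀ hW0 hWc _
      have hd0 : (0 : ℝ) ≤ d := Nat.cast_nonneg d
      have hkey : (d : ℝ) * (((m + 1 + d)! : ℕ) : ℝ) * Real.log b ≤
          d * c₂ ^ (d + 2) * Real.log b * t ^ (d + 2) := by
        have := hfacle.trans hWpow
        rw [mul_pow] at this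
        have h3 : (d : ℝ) * (((m + 1 + d)! : ℕ) : ℝ) ≤ d * (c₂ ^ (d + 2) * t ^ (d + 2)) :=
          mul_le_mul_of_nonneg_left this hd0
        have h4 := mul_le_mul_of_nonneg_right h3 hlogb0
        linarith
      have : 0 ≤ (d : ℝ) * ((2 * d + 1)! : ℕ) * Real.log b := by positivity
      linarith
  have hexp : Real.log 2 + (d * (k + d)! : ℕ) * Real.log b ≤ (C₁ + C₂) * t ^ (d + 2) := by
    have h2 : Real.log 2 ≤ Real.log 2 * t ^ (d + 2) := by
      have := mul_le_mul_of_nonneg_left htpow hlog2.le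
      linarith
    have h3 : (d : ℝ) * ((2 * d + 1)! : ℕ) * Real.log b ≤
        d * ((2 * d + 1)! : ℕ) * Real.log b * t ^ (d + 2) := by
      have h0 : 0 ≤ (d : ℝ) * ((2 * d + 1)! : ℕ) * Real.log b := by positivity
      have := mul_le_mul_of_nonneg_left htpow h0
      linarith
    push_cast
    rw [hC₁, hC₂]
    linarith [hfact, h2, h3]
  calc Real.exp (-((C₁ + C₂) * t ^ (d + 2)))
      ≤ Real.exp (-(Real.log 2 + (d * (k + d)! : ℕ) * Real.log b)) := Real.exp_le_exp.mpr (by linarith)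
    _ = 1 / (2 * (b : ℝ) ^ (d * (k + d)!)) := exp_neg_log_eq hb _
    _ ≤ _ := hI

end Measure

end Summit.Schanuel.Schanuel.Theorems.RootDecomp1KTHLayer

end
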